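import Literature.NumberTheory.Automorphic.GLnConstantTermTestFunctions        -- ★ B1 (p838251): `isLocallyConstant_and_hasCompactSupport_mul_constantTerm_levi`
import Literature.NumberTheory.Automorphic.GLnTwoBlockUnipotentHaarTransport    -- ★ D-S1: `det_boxAd_mul_det_boxAd_inv` (`det K_p · det K_{p⁻¹} = 1`)
import Literature.NumberTheory.Rogawski1990.LocalTransferFundamentalLemma       -- ★ the test-function class `Rogawski1990.IsLocSmooth` (= locally constant ∧ compact support)
import HarnessLib

/-!
# Smooth transport along the Levi: `‖det K_m‖_F` is locally constant on `P_c ⊇ M_c`, `‖det(1 − K_m)‖_F` on its regular locus,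
# and `h ↦ ψ(j̃ h) · φ^{(P)}(j̃ h)` is in `C_c^∞(H)` for any identification `j̃ : H ≃ M_c`

Topic `NumberTheory/Automorphic` (with a generic §1 and the `C_c^∞` heads of §4 in `Literature.NumberTheory.Rogawski1990`, where the
test-function class ★ `IsLocSmooth` lives); THEOREMS ONLY (no definition, no named fact, no instance, no notation, no `sorry`; net debt 0).
Cell `pub/hodgecm-mathlib`, F0∕P3a, road «D-N6s» (letter N6 = ★ `Rogawski1990.LocalTransferExplicit`, the local endoscopic transfer
`φ ↦ φ^H` of [Rogawski1990, Prop. 4.9.1 (a)] AT A PLACE SPLIT IN `L`, by parabolic descent [Rogawski1990, §4.13 Lemma 4.13.1 (a)]), brick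
«B5-A1 RIDERS» (LEAD F0P3a-plan (g8) T7-23 (C) ∕ T7-24 (A); cut-holder F0P3a-p03 (g9)): the two small analytic inputs of the assembly B5-A.
HC_CM is proved only modulo the printed citations until rung 0 closes; nothing printed is asserted here.

THE MATHEMATICS.  At a split place the transfer of `φ ∈ C_c^∞(GL₃(F))` to the Levi `M = GL₂ × GL₁` is `φ^H = ψ · φ^{(P)}|_M` with
`φ^{(P)}(m) = ∫_{K × U} φ(k (m u) k⁻¹)` the constant term (★ B1) and `ψ(m) = C · χ(m) · ‖det K_m‖_F^{1∕2}` a locally constant multiplier,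
`K_m = Ad(m)|_𝔫` the box of ★ D-S1 (`(K_p)_{(i,j),(i′,j′)} = p_{i i′} (p⁻¹)_{j′ j}`).  Two facts make `φ^H ∈ C_c^∞(H)`:
(a1) for `p` in the parabolic `P_c` the box `K_p` is invertible (★ `det_boxAd_mul_det_boxAd_inv`) and depends continuously on `p`, and the
normalised absolute value `‖·‖_F` is locally constant off `0` (Mathlib `Valuation.locally_const`), so `p ↦ ‖det K_p‖_F` is locally constant on
`P_c` (hence on `M_c`), and `p ↦ ‖det(1 − K_p)‖_F` is locally constant on the open locus `det(1 − K_p) ≠ 0`; (a2) `C_c^∞` is stable under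
locally constant multipliers and under homeomorphisms; (a3) hence, by ★ B1, `h ↦ ψ(j̃ h) · φ^{(P)}(j̃ h)` is locally constant with compact
support on any topological group `H` identified with `M_c` by `j̃ : H ≃ₜ* M_c` (at the split place: `H_v = U(Φ₂) × U(Φ₁) ≃ GL₂(L_w) × GL₁(L_w) ≃ M_{c₀}`,
★ `exists_continuousMulEquiv_prod_standardLeviGL_twoBlock`).

* §1 (ns `Rogawski1990`, generic): `IsLocSmooth.mul_left` ∕ `IsLocSmooth.mul_right` (locally constant multipliers), `IsLocSmooth.comp_homeomorph'`
  (forward composition; the `∘ e.symm` form is ★ `isLocSmooth_comp_homeomorph`).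
* §2 (generic `X`, `F` a non-archimedean local field): `eventually_normAbs_apply_eq`, `isLocallyConstant_normAbs_comp`,
  `isOpen_setOf_apply_ne_zero`, `isLocallyConstant_normAbs_comp_subtype` — `x ↦ ‖f x‖_F` is locally constant where `f ≠ 0`.
* §3 (index-generic `n`, two-block labelling `c : n → Bool`): `continuous_boxAd`, `continuous_det_boxAd`, `continuous_det_one_sub_boxAd`,
  `det_boxAd_ne_zero`, **`isLocallyConstant_normAbs_det_boxAd`** (on `P_c`), **`isLocallyConstant_normAbs_det_boxAd_levi`** (on `M_c`, the box of
  `m` READ IN `P_c` through `⟨↑m, standardLeviGL_le F c m.2⟩`), `isLocallyConstant_normAbs_det_boxAd_inclusion` (the same through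
  `Subgroup.inclusion (standardLeviGL_le F c)`, definitionally equal), `isOpen_setOf_det_one_sub_boxAd_ne_zero`,
  `eventually_normAbs_det_one_sub_boxAd_eq`, `isLocallyConstant_normAbs_det_one_sub_boxAd_subtype` (+ `_levi` readings).
* §4 (B1's setting `GL_n(F)`, `c : Fin n → α`, ANY measure `ρ` on `K × U_c`; ns `Rogawski1990`): **`isLocSmooth_mul_constantTerm_levi`**,
  **`isLocSmooth_mul_constantTerm_comp`** (`j̃ : H ≃ₜ* M_c`), `isLocSmooth_mul_constantTerm_comp_homeomorph` (`j̃ : H ≃ₜ M_c`), and the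
  (2,1) closing corollary **`isLocSmooth_mul_constantTerm_comp_twoOne`** at `c₀ = fun i : Fin (2 + 1) => decide (2 ≤ i)`.

## References
* [Rogawski1990] J. D. Rogawski, *Automorphic Representations of Unitary Groups in Three Variables*, Ann. of Math. Stud. 123 (1990), §4.9
  Prop. 4.9.1 (a) p. 55; §4.13 Lemma 4.13.1 (a) p. 64 and its proof pp. 64–66; §1.6 p. 6 (`C(G, ω)`).
* [BernsteinZelevinsky1977] I. N. Bernstein, A. V. Zelevinsky, *Induced representations of reductive `p`-adic groups I*, Ann. Sci. ÉNS 10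
  (1977), §2.1, §2.3 (the functor `r_{M,G}` on `C_c^∞`).
* [CartierCorvallis1979] P. Cartier, *Representations of `p`-adic groups: a survey*, PSPM 33.1 (1979), §IV.1–IV.2.
-/

set_option autoImplicit false

noncomputable section

open scoped MatrixGroups NNReal
open MeasureTheory Matrix Filter Topology ValuativeRel

/-! ## §1 `C_c^∞` is stable under locally constant multipliers and homeomorphisms -/

namespace Literature.NumberTheory.Rogawski1990

section LocSmooth

variable {X Y : Type*} [TopologicalSpace X] [TopologicalSpace Y]

/-- **A locally constant multiplier preserves `C_c^∞`** (left factor): `ψ` locally constant, `Φ ∈ C_c^∞ ⇒ ψ · Φ ∈ C_c^∞` — the slot for the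
factor `τ_v · δ_P^{1∕2}` (and the constant of the measure dictionary) of the split-place transfer. [cite: Rogawski1990, §4.13 Lemma 4.13.1 (a) p. 64; §1.6 p. 6] -/
theorem IsLocSmooth.mul_left {Φ ψ : X → ℂ} (hΦ : IsLocSmooth Φ) (hψ : IsLocallyConstant ψ) :
    IsLocSmooth fun x => ψ x * Φ x :=
  ⟨hψ.mul hΦ.isLocallyConstant, hΦ.hasCompactSupport.mul_left⟩

/-- A locally constant multiplier preserves `C_c^∞` (right factor). [cite: Rogawski1990, §4.13 Lemma 4.13.1 (a) p. 64; §1.6 p. 6] -/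
theorem IsLocSmooth.mul_right {Φ ψ : X → ℂ} (hΦ : IsLocSmooth Φ) (hψ : IsLocallyConstant ψ) :
    IsLocSmooth fun x => Φ x * ψ x :=
  ⟨hΦ.isLocallyConstant.mul hψ, hΦ.hasCompactSupport.mul_right⟩

/-- `C_c^∞` transports along a homeomorphism, forward-composition form `φ ↦ φ ∘ e` (the `φ ∘ e.symm` form is ★ `isLocSmooth_comp_homeomorph`).
[cite: Rogawski1990, §1.6 p. 6; §14.4 p. 237] -/
theorem IsLocSmooth.comp_homeomorph' (e : X ≃ₜ Y) {φ : Y → ℂ} (hφ : IsLocSmooth φ) : IsLocSmooth fun x => φ (e x) :=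
  ⟨hφ.isLocallyConstant.comp_continuous e.continuous, hφ.hasCompactSupport.comp_homeomorph e⟩

end LocSmooth

end Literature.NumberTheory.Rogawski1990

namespace Literature.NumberTheory.Automorphic

open Literature.NumberTheory.GaloisRepresentations.IsNonarchimedeanLocalField

/-! ## §2 `x ↦ ‖f x‖_F` is locally constant where `f ≠ 0` -/

section NormAbs

variable (F : Type*) [Field F] [ValuativeRel F] [TopologicalSpace F] [IsNonarchimedeanLocalField F]
  {X : Type*} [TopologicalSpace X]

/-- **`‖·‖_F` is locally constant off `0`, pulled back along a map continuous at a point**: if `f` is continuous at `x₀` and `f x₀ ≠ 0` then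
`‖f x‖_F = ‖f x₀‖_F` for `x` near `x₀` (the valuation is locally constant at non-zero points, Mathlib `Valuation.locally_const`).
[cite: CartierCorvallis1979, §IV.1] -/
theorem eventually_normAbs_apply_eq {f : X → F} {x₀ : X} (hf : ContinuousAt f x₀) (h0 : f x₀ ≠ 0) :
    ∀ᶠ x in 𝓝 x₀, normAbs F (f x) = normAbs F (f x₀) := by
  have h : {y : F | valuation F y = valuation F (f x₀)} ∈ 𝓝 (f x₀) :=
    Valuation.locally_const (valuation F) ((Valuation.ne_zero_iff _).2 h0)
  filter_upwards [hf.preimage_mem_nhds h] with x hx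
  rw [normAbs_apply, normAbs_apply, Set.mem_preimage.1 hx]

/-- **`x ↦ ‖f x‖_F` is locally constant for `f` continuous and nowhere zero.** [cite: CartierCorvallis1979, §IV.1] -/
theorem isLocallyConstant_normAbs_comp {f : X → F} (hf : Continuous f) (h0 : ∀ x, f x ≠ 0) :
    IsLocallyConstant fun x => normAbs F (f x) :=
  (IsLocallyConstant.iff_eventually_eq _).2 fun x => eventually_normAbs_apply_eq F hf.continuousAt (h0 x)

/-- The non-vanishing locus `{x | f x ≠ 0}` of a continuous `f : X → F` is open. [cite: CartierCorvallis1979, §IV.1] -/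
theorem isOpen_setOf_apply_ne_zero {f : X → F} (hf : Continuous f) : IsOpen {x | f x ≠ 0} := by
  haveI : T2Space F := (isLocalField F).toT2Space
  exact isOpen_compl_singleton.preimage hf

/-- `x ↦ ‖f x‖_F` is locally constant on the (open) non-vanishing locus of a continuous `f`. [cite: CartierCorvallis1979, §IV.1] -/
theorem isLocallyConstant_normAbs_comp_subtype {f : X → F} (hf : Continuous f) :
    IsLocallyConstant fun x : {x : X // f x ≠ 0} => normAbs F (f x) :=
  isLocallyConstant_normAbs_comp F (hf.comp continuous_subtype_val) fun x => x.2

end NormAbs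

/-! ## §3 The box `K_p = Ad(p)|_𝔫` of a two-block parabolic: continuity in `p`, `‖det K_p‖_F` and `‖det(1 − K_p)‖_F` locally constant -/

section Box

variable (F : Type*) [Field F] [ValuativeRel F] [TopologicalSpace F] [IsNonarchimedeanLocalField F]
  {n : Type*} [Fintype n] [DecidableEq n] (c : n → Bool)

/-- **The box `K_p` depends continuously on `p ∈ P_c`** (its entries are `p_{i i′} (p⁻¹)_{j′ j}`; inversion is continuous on `GL_n`).
[cite: BernsteinZelevinsky1977, §2.1] -/
theorem continuous_boxAd :
    Continuous fun p : ↥(standardParabolicGL F c) =>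
      (Matrix.of fun q q' : {i : n // c i = false} × {j : n // c j = true} =>
        ((p : GL n F) : Matrix n n F) q.1 q'.1 *
          (((p⁻¹ : standardParabolicGL F c) : GL n F) : Matrix n n F) q'.2 q.2) := by
  refine continuous_matrix fun q q' => ?_
  have h1 : Continuous fun p : ↥(standardParabolicGL F c) => ((p : GL n F) : Matrix n n F) q.1 q'.1 :=
    (Units.continuous_val.comp continuous_subtype_val).matrix_elem (q.1 : n) (q'.1 : n)
  have h2 : Continuous fun p : ↥(standardParabolicGL F c) =>
      (((p⁻¹ : standardParabolicGL F c) : GL n F) : Matrix n n F) q'.2 q.2 :=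
    (Units.continuous_coe_inv.comp continuous_subtype_val).matrix_elem (q'.2 : n) (q.2 : n)
  show Continuous fun p : ↥(standardParabolicGL F c) => ((p : GL n F) : Matrix n n F) q.1 q'.1 *
    (((p⁻¹ : standardParabolicGL F c) : GL n F) : Matrix n n F) q'.2 q.2
  exact h1.mul h2

/-- `p ↦ det K_p` is continuous on `P_c`. [cite: BernsteinZelevinsky1977, §2.1] -/
theorem continuous_det_boxAd :
    Continuous fun p : ↥(standardParabolicGL F c) =>
      (Matrix.of fun q q' : {i : n // c i = false} × {j : n // c j = true} =>
        ((p : GL n F) : Matrix n n F) q.1 q'.1 *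
          (((p⁻¹ : standardParabolicGL F c) : GL n F) : Matrix n n F) q'.2 q.2).det :=
  (continuous_boxAd F c).matrix_det

/-- `p ↦ det(1 − K_p)` is continuous on `P_c`. [cite: BernsteinZelevinsky1977, §2.1] -/
theorem continuous_det_one_sub_boxAd :
    Continuous fun p : ↥(standardParabolicGL F c) =>
      (1 - Matrix.of fun q q' : {i : n // c i = false} × {j : n // c j = true} =>
        ((p : GL n F) : Matrix n n F) q.1 q'.1 *
          (((p⁻¹ : standardParabolicGL F c) : GL n F) : Matrix n n F) q'.2 q.2).det :=
  (continuous_const.sub (continuous_boxAd F c)).matrix_det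

/-- `det K_p ≠ 0` for every `p ∈ P_c` (★ `det_boxAd_mul_det_boxAd_inv`: `det K_p · det K_{p⁻¹} = 1`). [cite: BernsteinZelevinsky1977, §2.1] -/
theorem det_boxAd_ne_zero (p : standardParabolicGL F c) :
    (Matrix.of fun q q' : {i : n // c i = false} × {j : n // c j = true} =>
        ((p : GL n F) : Matrix n n F) q.1 q'.1 *
          (((p⁻¹ : standardParabolicGL F c) : GL n F) : Matrix n n F) q'.2 q.2).det ≠ 0 :=
  left_ne_zero_of_mul_eq_one (det_boxAd_mul_det_boxAd_inv p)

/-- **(a1) `p ↦ ‖det K_p‖_F` is locally constant on the parabolic `P_c`** (the modulus `δ_P(p) = ‖det K_p‖_F` is a locally constant character;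
here: `K_p` invertible and continuous in `p`, `‖·‖_F` locally constant off `0`). [cite: Rogawski1990, §4.13 Lemma 4.13.1 (a) p. 64] [cite: BernsteinZelevinsky1977, §2.3] -/
theorem isLocallyConstant_normAbs_det_boxAd :
    IsLocallyConstant fun p : ↥(standardParabolicGL F c) =>
      normAbs F (Matrix.of fun q q' : {i : n // c i = false} × {j : n // c j = true} =>
        ((p : GL n F) : Matrix n n F) q.1 q'.1 *
          (((p⁻¹ : standardParabolicGL F c) : GL n F) : Matrix n n F) q'.2 q.2).det :=
  isLocallyConstant_normAbs_comp F (continuous_det_boxAd F c) (det_boxAd_ne_zero F c)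

omit [ValuativeRel F] [IsNonarchimedeanLocalField F] in
/-- The inclusion `M_c ↪ P_c`, `m ↦ ⟨↑m, standardLeviGL_le F c m.2⟩` (definitionally `Subgroup.inclusion (standardLeviGL_le F c)`), is continuous.
[cite: BernsteinZelevinsky1977, §2.1] -/
theorem continuous_standardLeviGL_inclusion :
    Continuous fun m : ↥(standardLeviGL F c) =>
      (⟨(m : GL n F), standardLeviGL_le F c m.2⟩ : ↥(standardParabolicGL F c)) :=
  continuous_subtype_val.subtype_mk _

/-- **(a1, Levi reading) `m ↦ ‖det K_m‖_F` is locally constant on the Levi `M_c`**, the box of `m ∈ M_c` being READ IN `P_c` through the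
inclusion `⟨↑m, standardLeviGL_le F c m.2⟩` (so that it is literally the `K_p` of ★ B2 at `p := ⟨↑m, _⟩`) — the `‖det K_m‖_F^{1∕2} = δ_P(m)^{1∕2}`
factor of the split-place transfer multiplier `ψ`. [cite: Rogawski1990, §4.13 Lemma 4.13.1 (a) p. 64; §4.9 Prop. 4.9.1 (a) p. 55] -/
theorem isLocallyConstant_normAbs_det_boxAd_levi :
    IsLocallyConstant fun m : ↥(standardLeviGL F c) =>
      normAbs F (Matrix.of fun q q' : {i : n // c i = false} × {j : n // c j = true} =>
        (((⟨(m : GL n F), standardLeviGL_le F c m.2⟩ : ↥(standardParabolicGL F c)) : GL n F) : Matrix n n F) q.1 q'.1 *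
          ((((⟨(m : GL n F), standardLeviGL_le F c m.2⟩ : ↥(standardParabolicGL F c))⁻¹ : standardParabolicGL F c) : GL n F) :
            Matrix n n F) q'.2 q.2).det :=
  (isLocallyConstant_normAbs_det_boxAd F c).comp_continuous (continuous_standardLeviGL_inclusion F c)

/-- (a1, Levi reading through `Subgroup.inclusion`) the same with the inclusion `M_c ↪ P_c` spelled `Subgroup.inclusion (standardLeviGL_le F c)`
(definitionally the anonymous-constructor reading above). [cite: Rogawski1990, §4.13 Lemma 4.13.1 (a) p. 64; §4.9 Prop. 4.9.1 (a) p. 55] -/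
theorem isLocallyConstant_normAbs_det_boxAd_inclusion :
    IsLocallyConstant fun m : ↥(standardLeviGL F c) =>
      normAbs F (Matrix.of fun q q' : {i : n // c i = false} × {j : n // c j = true} =>
        (((Subgroup.inclusion (standardLeviGL_le F c) m : ↥(standardParabolicGL F c)) : GL n F) : Matrix n n F) q.1 q'.1 *
          ((((Subgroup.inclusion (standardLeviGL_le F c) m)⁻¹ : standardParabolicGL F c) : GL n F) :
            Matrix n n F) q'.2 q.2).det :=
  (isLocallyConstant_normAbs_det_boxAd F c).comp_continuous (continuous_standardLeviGL_inclusion F c)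

/-- **The regular locus `{p ∈ P_c | det(1 − K_p) ≠ 0}` is open** (`|D_{G∕M}(p)| ≠ 0`). [cite: Rogawski1990, §4.13 Lemma 4.13.1 (a) p. 64] -/
theorem isOpen_setOf_det_one_sub_boxAd_ne_zero :
    IsOpen {p : ↥(standardParabolicGL F c) |
      (1 - Matrix.of fun q q' : {i : n // c i = false} × {j : n // c j = true} =>
        ((p : GL n F) : Matrix n n F) q.1 q'.1 *
          (((p⁻¹ : standardParabolicGL F c) : GL n F) : Matrix n n F) q'.2 q.2).det ≠ 0} :=
  isOpen_setOf_apply_ne_zero F (continuous_det_one_sub_boxAd F c)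

/-- **(a1′) `p ↦ ‖det(1 − K_p)‖_F` is locally constant on the regular locus**, eventual form: if `det(1 − K_{p₀}) ≠ 0` then
`‖det(1 − K_p)‖_F = ‖det(1 − K_{p₀})‖_F` for `p` near `p₀` in `P_c` (the `|D_{G∕M}|^{1∕2} = ‖det(1 − K)‖_F ‖det K‖_F^{−1∕2}` factor of the transfer
factor is locally constant on the `G`-regular set). [cite: Rogawski1990, §4.13 Lemma 4.13.1 (a) p. 64; §4.9 p. 55] -/
theorem eventually_normAbs_det_one_sub_boxAd_eq {p₀ : ↥(standardParabolicGL F c)}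
    (h : (1 - Matrix.of fun q q' : {i : n // c i = false} × {j : n // c j = true} =>
        ((p₀ : GL n F) : Matrix n n F) q.1 q'.1 *
          (((p₀⁻¹ : standardParabolicGL F c) : GL n F) : Matrix n n F) q'.2 q.2).det ≠ 0) :
    ∀ᶠ p : ↥(standardParabolicGL F c) in 𝓝 p₀,
      normAbs F (1 - Matrix.of fun q q' : {i : n // c i = false} × {j : n // c j = true} =>
          ((p : GL n F) : Matrix n n F) q.1 q'.1 *
            (((p⁻¹ : standardParabolicGL F c) : GL n F) : Matrix n n F) q'.2 q.2).det =
        normAbs F (1 - Matrix.of fun q q' : {i : n // c i = false} × {j : n // c j = true} =>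
          ((p₀ : GL n F) : Matrix n n F) q.1 q'.1 *
            (((p₀⁻¹ : standardParabolicGL F c) : GL n F) : Matrix n n F) q'.2 q.2).det :=
  eventually_normAbs_apply_eq F (continuous_det_one_sub_boxAd F c).continuousAt h

/-- (a1′, subtype form) `p ↦ ‖det(1 − K_p)‖_F` is locally constant on the regular locus `{det(1 − K_p) ≠ 0}` of `P_c`.
[cite: Rogawski1990, §4.13 Lemma 4.13.1 (a) p. 64; §4.9 p. 55] -/
theorem isLocallyConstant_normAbs_det_one_sub_boxAd_subtype :
    IsLocallyConstant fun p : {p : ↥(standardParabolicGL F c) //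
        (1 - Matrix.of fun q q' : {i : n // c i = false} × {j : n // c j = true} =>
          ((p : GL n F) : Matrix n n F) q.1 q'.1 *
            (((p⁻¹ : standardParabolicGL F c) : GL n F) : Matrix n n F) q'.2 q.2).det ≠ 0} =>
      normAbs F (1 - Matrix.of fun q q' : {i : n // c i = false} × {j : n // c j = true} =>
          (((p : ↥(standardParabolicGL F c)) : GL n F) : Matrix n n F) q.1 q'.1 *
            ((((p : ↥(standardParabolicGL F c))⁻¹ : standardParabolicGL F c) : GL n F) : Matrix n n F) q'.2 q.2).det :=
  isLocallyConstant_normAbs_comp_subtype F (continuous_det_one_sub_boxAd F c)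

/-- (a1′, Levi reading, eventual form) for `m₀ ∈ M_c` with `det(1 − K_{m₀}) ≠ 0` (box read in `P_c`), `‖det(1 − K_m)‖_F = ‖det(1 − K_{m₀})‖_F` for
`m` near `m₀` in `M_c`. [cite: Rogawski1990, §4.13 Lemma 4.13.1 (a) p. 64; §4.9 p. 55] -/
theorem eventually_normAbs_det_one_sub_boxAd_levi_eq {m₀ : ↥(standardLeviGL F c)}
    (h : (1 - Matrix.of fun q q' : {i : n // c i = false} × {j : n // c j = true} =>
        (((⟨(m₀ : GL n F), standardLeviGL_le F c m₀.2⟩ : ↥(standardParabolicGL F c)) : GL n F) : Matrix n n F) q.1 q'.1 *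
          ((((⟨(m₀ : GL n F), standardLeviGL_le F c m₀.2⟩ : ↥(standardParabolicGL F c))⁻¹ : standardParabolicGL F c) : GL n F) :
            Matrix n n F) q'.2 q.2).det ≠ 0) :
    ∀ᶠ m : ↥(standardLeviGL F c) in 𝓝 m₀,
      normAbs F (1 - Matrix.of fun q q' : {i : n // c i = false} × {j : n // c j = true} =>
          (((⟨(m : GL n F), standardLeviGL_le F c m.2⟩ : ↥(standardParabolicGL F c)) : GL n F) : Matrix n n F) q.1 q'.1 *
            ((((⟨(m : GL n F), standardLeviGL_le F c m.2⟩ : ↥(standardParabolicGL F c))⁻¹ : standardParabolicGL F c) : GL n F) :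
              Matrix n n F) q'.2 q.2).det =
        normAbs F (1 - Matrix.of fun q q' : {i : n // c i = false} × {j : n // c j = true} =>
          (((⟨(m₀ : GL n F), standardLeviGL_le F c m₀.2⟩ : ↥(standardParabolicGL F c)) : GL n F) : Matrix n n F) q.1 q'.1 *
            ((((⟨(m₀ : GL n F), standardLeviGL_le F c m₀.2⟩ : ↥(standardParabolicGL F c))⁻¹ : standardParabolicGL F c) : GL n F) :
              Matrix n n F) q'.2 q.2).det :=
  eventually_normAbs_apply_eq F ((continuous_det_one_sub_boxAd F c).comp (continuous_standardLeviGL_inclusion F c)).continuousAt h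

end Box

end Literature.NumberTheory.Automorphic

/-! ## §4 `h ↦ ψ(j̃ h) · φ^{(P)}(j̃ h) ∈ C_c^∞(H)` for `j̃ : H ≃ M_c` -/

namespace Literature.NumberTheory.Rogawski1990

open Literature.NumberTheory.Automorphic

section ConstantTerm

variable (F : Type*) [Field F] [ValuativeRel F] [TopologicalSpace F] [IsNonarchimedeanLocalField F]
  {n : ℕ} {α : Type*} [LinearOrder α] [Fintype α] (c : Fin n → α)
  [MeasurableSpace (↥(glInt n F) × ↥(unipotentRadicalGL F c))]
  (ρ : Measure (↥(glInt n F) × ↥(unipotentRadicalGL F c)))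

/-- **`ψ · φ^{(P)}|_{M_c} ∈ C_c^∞(M_c)`** (★ B1, packaged in the class ★ `IsLocSmooth`): for `φ ∈ C_c^∞(GL_n(F))` (locally constant, compact support) and
`ψ : M_c → ℂ` locally constant, `m ↦ ψ(m) · ∫_{K × U_c} φ(k (m u) k⁻¹) dρ` is locally constant with compact support on `M_c`, for ANY measure `ρ`.
[cite: Rogawski1990, §4.13 Lemma 4.13.1 (a) p. 64; §4.9 Prop. 4.9.1 (a) p. 55] [cite: BernsteinZelevinsky1977, §2.3] -/
theorem isLocSmooth_mul_constantTerm_levi {φ : GL (Fin n) F → ℂ} (hlc : IsLocallyConstant φ) (hcs : HasCompactSupport φ)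
    {ψ : ↥(standardLeviGL F c) → ℂ} (hψ : IsLocallyConstant ψ) :
    IsLocSmooth fun m : ↥(standardLeviGL F c) => ψ m *
      ∫ q, φ ((q.1 : GL (Fin n) F) * ((m : GL (Fin n) F) * (q.2 : GL (Fin n) F)) * (q.1 : GL (Fin n) F)⁻¹) ∂ρ :=
  isLocallyConstant_and_hasCompactSupport_mul_constantTerm_levi F c ρ hlc hcs hψ

/-- **(a3) `h ↦ ψ(j̃ h) · φ^{(P)}(j̃ h) ∈ C_c^∞(H)` for a topological-group identification `j̃ : H ≃ₜ* M_c`** — the split-place transfer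
`φ^H := (ψ · φ^{(P)}) ∘ j̃` IS a test function on `H` (`H_v ≅ GL₂(L_w) × GL₁(L_w) ≅ M_{c₀}`): `φ` locally constant with compact support on `GL_n(F)`,
`ψ : M_c → ℂ` locally constant (e.g. `C · χ · ‖det K‖_F^{1∕2}` with `χ` locally constant, ★ `isLocallyConstant_normAbs_det_boxAd_levi`), ANY `ρ`.
[cite: Rogawski1990, §4.9 Prop. 4.9.1 (a) p. 55; §4.13 Lemma 4.13.1 (a) p. 64] [cite: BernsteinZelevinsky1977, §2.3] -/
theorem isLocSmooth_mul_constantTerm_comp {φ : GL (Fin n) F → ℂ} (hlc : IsLocallyConstant φ) (hcs : HasCompactSupport φ)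
    {ψ : ↥(standardLeviGL F c) → ℂ} (hψ : IsLocallyConstant ψ)
    {H : Type*} [Mul H] [TopologicalSpace H] (j : H ≃ₜ* ↥(standardLeviGL F c)) :
    IsLocSmooth fun h : H => ψ (j h) *
      ∫ q, φ ((q.1 : GL (Fin n) F) * (((j h : ↥(standardLeviGL F c)) : GL (Fin n) F) * (q.2 : GL (Fin n) F)) *
        (q.1 : GL (Fin n) F)⁻¹) ∂ρ :=
  (isLocSmooth_mul_constantTerm_levi F c ρ hlc hcs hψ).comp_homeomorph' j.toHomeomorph

/-- (a3, bare homeomorphism) the same for any homeomorphism `j̃ : H ≃ₜ M_c`. [cite: Rogawski1990, §4.9 Prop. 4.9.1 (a) p. 55; §4.13 Lemma 4.13.1 (a) p. 64] -/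
theorem isLocSmooth_mul_constantTerm_comp_homeomorph {φ : GL (Fin n) F → ℂ} (hlc : IsLocallyConstant φ) (hcs : HasCompactSupport φ)
    {ψ : ↥(standardLeviGL F c) → ℂ} (hψ : IsLocallyConstant ψ)
    {H : Type*} [TopologicalSpace H] (j : H ≃ₜ ↥(standardLeviGL F c)) :
    IsLocSmooth fun h : H => ψ (j h) *
      ∫ q, φ ((q.1 : GL (Fin n) F) * (((j h : ↥(standardLeviGL F c)) : GL (Fin n) F) * (q.2 : GL (Fin n) F)) *
        (q.1 : GL (Fin n) F)⁻¹) ∂ρ :=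
  (isLocSmooth_mul_constantTerm_levi F c ρ hlc hcs hψ).comp_homeomorph' j

end ConstantTerm

section TwoOne

variable (F : Type*) [Field F] [ValuativeRel F] [TopologicalSpace F] [IsNonarchimedeanLocalField F]
  [MeasurableSpace (↥(glInt (2 + 1) F) × ↥(unipotentRadicalGL F (fun i : Fin (2 + 1) => decide (2 ≤ (i : ℕ)))))]
  (ρ : Measure (↥(glInt (2 + 1) F) × ↥(unipotentRadicalGL F (fun i : Fin (2 + 1) => decide (2 ≤ (i : ℕ))))))

/-- **(a3) at the `(2,1)` Levi of `GL₃` — the closing corollary the split-place assembly imports**: with `c₀ = fun i : Fin (2 + 1) => decide (2 ≤ i)`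
(the labelling of ★ `exists_continuousMulEquiv_prod_standardLeviGL_twoBlock` at `(k, l) = (2, 1)`, so `j̃ := (e₂ × e₁).trans e_M : H_v ≃ₜ* M_{c₀}` docks
literally), `h ↦ ψ(j̃ h) · ∫_{K × U} φ(k ((j̃ h) u) k⁻¹) dρ ∈ C_c^∞(H_v)`. [cite: Rogawski1990, §4.9 Prop. 4.9.1 (a) p. 55; §4.13 Lemma 4.13.1 (a) p. 64] -/
theorem isLocSmooth_mul_constantTerm_comp_twoOne {φ : GL (Fin (2 + 1)) F → ℂ} (hlc : IsLocallyConstant φ) (hcs : HasCompactSupport φ)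
    {ψ : ↥(standardLeviGL F (fun i : Fin (2 + 1) => decide (2 ≤ (i : ℕ)))) → ℂ} (hψ : IsLocallyConstant ψ)
    {H : Type*} [Mul H] [TopologicalSpace H] (j : H ≃ₜ* ↥(standardLeviGL F (fun i : Fin (2 + 1) => decide (2 ≤ (i : ℕ))))) :
    IsLocSmooth fun h : H => ψ (j h) *
      ∫ q, φ ((q.1 : GL (Fin (2 + 1)) F) *
        (((j h : ↥(standardLeviGL F (fun i : Fin (2 + 1) => decide (2 ≤ (i : ℕ))))) : GL (Fin (2 + 1)) F) * (q.2 : GL (Fin (2 + 1)) F)) *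
        (q.1 : GL (Fin (2 + 1)) F)⁻¹) ∂ρ :=
  isLocSmooth_mul_constantTerm_comp F (fun i : Fin (2 + 1) => decide (2 ≤ (i : ℕ))) ρ hlc hcs hψ j

end TwoOne

end Literature.NumberTheory.Rogawski1990

end
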